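import Mathlib
import Summits.Ventures.PercRepro2.K5Kernel

/-!
# The `K₅` kernel certificates of the weighted (PM) per-side brackets `(HALF-PM⁺)_L`, `(HALF-PM⁺)_H`
and of the sharpening `(C4)` (blind cell PercRepro2, mine-2 g22; row 2′BETA1; proofs/MINE2-CUTU.md §11,
conjectures/MINE-2.md M2-44 (27)(d) «a kernel-checked certificate for one skeleton»)

`K₅` on the five marks `o = 0, a₁ = 1, a₂ = 2, u = 3, b = 4` (the host `u` of the pendant `a₃` takes the
place of `a₃` in `K5Kernel.lean`'s numbering), configurations `ω : Fin 10 → Bool`, connectivity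
`K5.conn` (bitmask closure, `K5Conn.conn_iff`).  With `Q = {a₁ ↮ a₂}`, `L_x = {x ∈ C(a₁)}`,
`H_x = {x ∈ C(a₂)}`, `oU = L_o ∪ H_o`, the cleared per-side brackets of the weighted (PM) are

  `P(Q)³ · (HALF-PM⁺)_L = P(Q)·[P(Q)P(L_b H_u oU Q) − P(L_b Q)P(H_u oU Q)]
      − P(oU Q)·[P(Q)P(L_b H_u Q) − P(L_b Q)P(H_u Q)] − P(Q)·[P(Q)P(L_b H_o Q) − P(L_b Q)P(H_o Q)]`

(`CutMixedPM.halfL_mixed_nonneg`, `RootPairSepPM.halfL_nonneg_of_u_alone`), its mirror `(HALF-PM⁺)_H`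
(`a₁ ↔ a₂` for `b`, `u`: `H_b`, `L_u` in place of `L_b`, `H_u`), and the sharpening

  `P(Q)³ · (C4) = P(Q)·[P(Q)P(L_b H_u L_o Q) − P(L_b Q)P(H_u L_o Q)] − P(oU Q)·[P(Q)P(L_b H_u Q) − P(L_b Q)P(H_u Q)]`.

Each is a sum of products of three masses, every mass the Bernstein-1 form of a Boolean table below.
**Kronecker substitution** (`K5Kernel.lean`, typer-1 g9): `kron T = Σ_ω [T ω] · KB^{idx ω}` with `KB = 2^20`; a
product of three encodings carries, digit by digit (base `KB`, digit `idx4 k` for the profile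
`k ∈ {0,1,2,3}^10`), the 3-copy class sums = the degree-3 tensor-Bernstein coefficients of the product of
the three masses (`K5Kron.kronSum_mul_mul`).  So `kPosL` / `kNegL` carry the positive / negative parts of every
coefficient of the cleared `(HALF-PM⁺)_L`; the coefficients are `≤ 3 · 3^10 = 177147 < 2^19`.

**The certificates** (`certL`, `certH`, `certC4`; one `decide +kernel` each): `kNeg ≤ kPos`,
`Nat.land (kPos − kNeg) mask = 0`, `Nat.land kNeg mask = 0` — the mask tests bit `19` of every base-`KB` digit,
so the subtraction borrowed nowhere: `kPos ≥ kNeg` DIGITWISE, i.e. every tensor-Bernstein coefficient of the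
cleared bracket is `≥ 0` (mine-2's (TB) on `K₅`, Theorem 11's unique `n = 5, m = 10` skeleton — now in the kernel).
No `native_decide`, no data file.  The bridge to the per-side brackets for every weight vector `p ∈ [0,1]^10`
(hence for every simple graph on the five marks, the missing edges at weight `0`) is `PMK5Theorem.lean`.
-/

namespace Summit.Ventures.PercRepro2

namespace K5

namespace PM

/-! ## The event tables (marks `o = 0, a₁ = 1, a₂ = 2, u = 3, b = 4`) -/

/-- `Q ∩ {u ∈ C₂}`. -/
def tQHu (ω : Fin 10 → Bool) : Bool := tQ ω && conn ω 2 3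
/-- `Q ∩ {o ∈ C₁ ∪ C₂}`. -/
def tQoU (ω : Fin 10 → Bool) : Bool := tQ ω && (conn ω 1 0 || conn ω 2 0)
/-- `Q ∩ {b ∈ C₁} ∩ {u ∈ C₂} ∩ {o ∈ C₁ ∪ C₂}`. -/
def tQBLHuoU (ω : Fin 10 → Bool) : Bool := tQ ω && conn ω 1 4 && conn ω 2 3 && (conn ω 1 0 || conn ω 2 0)
/-- `Q ∩ {u ∈ C₂} ∩ {o ∈ C₁ ∪ C₂}`. -/
def tQHuoU (ω : Fin 10 → Bool) : Bool := tQ ω && conn ω 2 3 && (conn ω 1 0 || conn ω 2 0)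
/-- `Q ∩ {b ∈ C₁} ∩ {u ∈ C₂}`. -/
def tQBLHu (ω : Fin 10 → Bool) : Bool := tQ ω && conn ω 1 4 && conn ω 2 3
/-- `Q ∩ {b ∈ C₁} ∩ {o ∈ C₂}`. -/
def tQBLHo (ω : Fin 10 → Bool) : Bool := tQ ω && conn ω 1 4 && conn ω 2 0
/-- `Q ∩ {o ∈ C₂}`. -/
def tQHo (ω : Fin 10 → Bool) : Bool := tQ ω && conn ω 2 0
/-- `Q ∩ {o ∈ C₁}`. -/
def tQLo (ω : Fin 10 → Bool) : Bool := tQ ω && conn ω 1 0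
/-- `Q ∩ {b ∈ C₁} ∩ {u ∈ C₂} ∩ {o ∈ C₁}`. -/
def tQBLHuLo (ω : Fin 10 → Bool) : Bool := tQ ω && conn ω 1 4 && conn ω 2 3 && conn ω 1 0
/-- `Q ∩ {u ∈ C₂} ∩ {o ∈ C₁}`. -/
def tQHuLo (ω : Fin 10 → Bool) : Bool := tQ ω && conn ω 2 3 && conn ω 1 0
/-- `Q ∩ {u ∈ C₁}` (the mirror). -/
def tQLu (ω : Fin 10 → Bool) : Bool := tQ ω && conn ω 1 3
/-- `Q ∩ {b ∈ C₂} ∩ {u ∈ C₁} ∩ {o ∈ C₁ ∪ C₂}` (the mirror). -/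
def tQBLuoU (ω : Fin 10 → Bool) : Bool := tQ ω && conn ω 2 4 && conn ω 1 3 && (conn ω 1 0 || conn ω 2 0)
/-- `Q ∩ {u ∈ C₁} ∩ {o ∈ C₁ ∪ C₂}` (the mirror). -/
def tQLuoU (ω : Fin 10 → Bool) : Bool := tQ ω && conn ω 1 3 && (conn ω 1 0 || conn ω 2 0)
/-- `Q ∩ {b ∈ C₂} ∩ {u ∈ C₁}` (the mirror). -/
def tQBLu (ω : Fin 10 → Bool) : Bool := tQ ω && conn ω 2 4 && conn ω 1 3
/-- `Q ∩ {b ∈ C₂} ∩ {o ∈ C₁}` (the mirror). -/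
def tQBLo (ω : Fin 10 → Bool) : Bool := tQ ω && conn ω 2 4 && conn ω 1 0

/-! ## Kronecker numbers -/

/-- The positive part of the cleared `(HALF-PM⁺)_L`:
`kron(L_bH_uoUQ)·kron Q·kron Q + kron(L_bQ)·kron(H_uQ)·kron(oUQ) + kron(L_bQ)·kron(H_oQ)·kron Q`. -/
def kPosL : ℕ := kron tQBLHuoU * kron tQ * kron tQ + kron tQBL * kron tQHu * kron tQoU +
  kron tQBL * kron tQHo * kron tQ

/-- The negative part of the cleared `(HALF-PM⁺)_L`:
`kron(L_bQ)·kron(H_uoUQ)·kron Q + kron(oUQ)·kron Q·kron(L_bH_uQ) + kron Q·kron Q·kron(L_bH_oQ)`. -/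
def kNegL : ℕ := kron tQBL * kron tQHuoU * kron tQ + kron tQoU * kron tQ * kron tQBLHu +
  kron tQ * kron tQ * kron tQBLHo

/-- The positive part of the cleared `(HALF-PM⁺)_H` (the mirror). -/
def kPosH : ℕ := kron tQBLuoU * kron tQ * kron tQ + kron tQB * kron tQLu * kron tQoU +
  kron tQB * kron tQLo * kron tQ

/-- The negative part of the cleared `(HALF-PM⁺)_H` (the mirror). -/
def kNegH : ℕ := kron tQB * kron tQLuoU * kron tQ + kron tQoU * kron tQ * kron tQBLu +
  kron tQ * kron tQ * kron tQBLo

/-- The positive part of the cleared `(C4)`: `kron(L_bH_uL_oQ)·kron Q·kron Q + kron(L_bQ)·kron(H_uQ)·kron(oUQ)`. -/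
def kPosC4 : ℕ := kron tQBLHuLo * kron tQ * kron tQ + kron tQBL * kron tQHu * kron tQoU

/-- The negative part of the cleared `(C4)`: `kron(L_bQ)·kron(H_uL_oQ)·kron Q + kron(oUQ)·kron Q·kron(L_bH_uQ)`. -/
def kNegC4 : ℕ := kron tQBL * kron tQHuLo * kron tQ + kron tQoU * kron tQ * kron tQBLHu

/-! ## The certificates -/

set_option maxRecDepth 100000 in
set_option maxHeartbeats 0 in
/-- **The `K₅` certificate of `(HALF-PM⁺)_L`** — every degree-3 tensor-Bernstein coefficient of the cleared
L-half of the weighted (PM) is `≥ 0`: `kPosL ≥ kNegL` digitwise (no borrow anywhere). -/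
theorem certL : kNegL ≤ kPosL ∧ Nat.land (kPosL - kNegL) mask = 0 ∧ Nat.land kNegL mask = 0 := by
  decide +kernel

set_option maxRecDepth 100000 in
set_option maxHeartbeats 0 in
/-- **The `K₅` certificate of `(HALF-PM⁺)_H`** — every coefficient of the cleared H-half is `≥ 0`. -/
theorem certH : kNegH ≤ kPosH ∧ Nat.land (kPosH - kNegH) mask = 0 ∧ Nat.land kNegH mask = 0 := by
  decide +kernel

set_option maxRecDepth 100000 in
set_option maxHeartbeats 0 in
/-- **The `K₅` certificate of `(C4)`** — every coefficient of the cleared sharpening `(C4)` is `≥ 0`. -/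
theorem certC4 : kNegC4 ≤ kPosC4 ∧ Nat.land (kPosC4 - kNegC4) mask = 0 ∧ Nat.land kNegC4 mask = 0 := by
  decide +kernel

end PM

end K5

end Summit.Ventures.PercRepro2
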